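import Mathlib
import Literature.Analysis.PDE.FarChannelClaim
import Literature.Analysis.PDE.FarChannelCoreLemmas
import Literature.Analysis.PDE.FarKernelCombos
import HarnessLib

/-!
# The far-side channel estimate at the unit scale (exponent `n ≥ 1`)

Analysis/PDE support file (everything proved). `far_channel_core`: for `n ≥ 1` there are
`ε₀ > 0` and `c > 0` such that for every continuous potential `P ≥ 0` of inverse-square type
beyond `3/8` — `P = n(n+1)/z² + q`, `|q| ≤ ε z^{-5/2}`, `ε ≤ ε₀` — and every global `C²` solution
`ψ` of `ψ_tt − ψ_zz + P ψ = 0`,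

  `c · inf_{p ∈ 𝒫} ∫⁻_{z>1} e_P[ψ − p](0) ≤ liminf_{t→+∞} ∫⁻_{z>1+|t|} e_P[ψ](t) + liminf_{t→−∞} (same)`,

where `𝒫` is the set of `t`-polynomial `C²` solutions on the far region `{z > 1 + |t|}`. Proof:
infinite data energy makes the right side infinite (`Wave1DSpatialReflection.lean`); otherwise the
claim (`FarChannelClaim.lean`) applied to `ψ − k` for every true kernel combination `k`
(`FarKernelCombos.lean`; these restrict to members of `𝒫`, carry no channel energy and form a
linear family) gives `X ≤ 2A L + Θε² X + δ` for the infimum `X` of the data energies of `ψ − k`,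
which absorbs for `Θ ε² ≤ ½` (`FarChannelCoreLemmas.lean`). Route PhotonSphereChannels,
`FixedModeChannels`, far side (stmt-FinalStateConjecture-10048). Folklore in method
(Duyckaerts–Kenig–Merle), new in this generality for the Regge–Wheeler-type far field.
-/

noncomputable section

namespace Literature.Analysis.PDE

open MeasureTheory Set Filter Topology Finset Real

/-- **Far-side channel estimate at the unit scale, `n ≥ 1`.** See the module docstring.
[folklore] -/
theorem far_channel_core (n : ℕ) (hn : 1 ≤ n) :
    ∃ ε₀ : ℝ, 0 < ε₀ ∧ ∃ c : ℝ, 0 < c ∧ ∀ {P q : ℝ → ℝ} {ε : ℝ}, Continuous P → (∀ z, 0 ≤ P z) →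
      Continuous q → 0 ≤ ε → ε ≤ ε₀ →
      (∀ z, 3 / 8 ≤ z → P z = (n : ℝ) * (n + 1) / z ^ 2 + q z) →
      (∀ z, 3 / 8 ≤ z → |q z| ≤ ε * z ^ (-(5 : ℝ) / 2)) →
    ∀ ψ : ℝ → ℝ → ℝ, ContDiff ℝ 2 (Function.uncurry ψ) →
      (∀ t z, iteratedDeriv 2 (fun τ => ψ τ z) t - iteratedDeriv 2 (ψ t) z + P z * ψ t z = 0) →
      ∃ 𝒦 : Set (ℝ → ℝ → ℝ), 𝒦.Nonempty ∧
        (∀ k ∈ 𝒦, ContDiff ℝ 2 (Function.uncurry k) ∧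
          (∀ t z, (1 : ℝ) ≤ z →
            iteratedDeriv 2 (fun τ => k τ z) t - iteratedDeriv 2 (k t) z + P z * k t z = 0) ∧
          ∃ (N : ℕ) (A : ℕ → ℝ → ℝ), ∀ t z, (7 / 8 : ℝ) ≤ z →
            k t z = ∑ i ∈ Finset.range N, A i z * t ^ i) ∧
      ENNReal.ofReal c * (⨅ k ∈ 𝒦,
        ∫⁻ z in Ioi 1, ENNReal.ofReal (deriv (fun τ => ψ τ z - k τ z) 0 ^ 2
          + deriv (fun y => ψ 0 y - k 0 y) z ^ 2 + P z * (ψ 0 z - k 0 z) ^ 2))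
      ≤ liminf (fun t => ∫⁻ z in Ioi (1 + |t|), ENNReal.ofReal
          (deriv (fun τ => ψ τ z) t ^ 2 + deriv (ψ t) z ^ 2 + P z * ψ t z ^ 2)) atTop
        + liminf (fun t => ∫⁻ z in Ioi (1 + |t|), ENNReal.ofReal
          (deriv (fun τ => ψ τ z) t ^ 2 + deriv (ψ t) z ^ 2 + P z * ψ t z ^ 2)) atBot := by
  classical
  obtain ⟨Kc, hKc0, hcombos⟩ := exists_farKernelCombos n
  obtain ⟨A, Θ, hA, hΘ, hclaim⟩ := far_channel_claim n hn hKc0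
  refine ⟨min (1 / 64) (1 / (2 * Θ + 2)), by positivity, 1 / (4 * A + 4), by positivity, ?_⟩
  intro P q ε hPc hP0 hq hε hε0 hPq hqb ψ hψ hsol
  have hε1 : ε ≤ 1 / 64 := hε0.trans (min_le_left _ _)
  have hθ0 : 0 ≤ Θ * ε ^ 2 := by positivity
  have hθ : Θ * ε ^ 2 ≤ 1 / 2 := by
    have h1 : ε ≤ 1 / (2 * Θ + 2) := hε0.trans (min_le_right _ _)
    have h2 : ε ^ 2 ≤ ε := by nlinarith
    have h3 : Θ * ε ≤ Θ * (1 / (2 * Θ + 2)) := mul_le_mul_of_nonneg_left h1 hΘ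
    have h4 : Θ * (1 / (2 * Θ + 2)) ≤ 1 / 2 := by
      rw [mul_one_div, div_le_iff₀ (by positivity)]; nlinarith
    nlinarith [mul_le_mul_of_nonneg_left h2 hΘ]
  -- abbreviations
  set Eext : ℝ → ENNReal := fun t => ∫⁻ z in Ioi (1 + |t|), ENNReal.ofReal
    (deriv (fun τ => ψ τ z) t ^ 2 + deriv (ψ t) z ^ 2 + P z * ψ t z ^ 2) with hEext
  obtain ⟨B, hB⟩ := hcombos hPc hP0 hq hε hε1 hPq hqb
  -- the comparison family
  set kf : (ℕ → ℝ) × (ℕ → ℝ) → ℝ → ℝ → ℝ := fun v t z =>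
    ∑ m ∈ range (n + 1), v.1 m * B 0 m t z + ∑ m ∈ range n, v.2 m * B 1 m t z with hkf
  have hKfacts : ∀ k ∈ Set.range kf, ContDiff ℝ 2 (Function.uncurry k) ∧
      (∀ t z, (1 : ℝ) ≤ z →
        iteratedDeriv 2 (fun τ => k τ z) t - iteratedDeriv 2 (k t) z + P z * k t z = 0) ∧
      ∃ (N : ℕ) (A : ℕ → ℝ → ℝ), ∀ t z, (7 / 8 : ℝ) ≤ z →
        k t z = ∑ i ∈ Finset.range N, A i z * t ^ i := by
    rintro _ ⟨v, rfl⟩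
    obtain ⟨hkC, -, hkeq, hst, -⟩ := hB v.1 v.2
    exact ⟨hkC, hkeq, hst⟩
  have hKne : (Set.range kf).Nonempty := Set.range_nonempty _
  refine ⟨Set.range kf, hKne, hKfacts, ?_⟩
  -- infinite data energy: the right side is infinite
  by_cases htop : (∫⁻ z in Ioi 1, ENNReal.ofReal
      (deriv (fun τ => ψ τ z) 0 ^ 2 + deriv (ψ 0) z ^ 2 + P z * ψ 0 z ^ 2)) = ⊤
  · have hall : ∀ t, Eext t = ⊤ := fun t =>
      wave1D_farEnergy_eq_top_of_initial_eq_top hPc hP0 hψ hsol htop t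
    have hl : liminf Eext atTop = ⊤ := by
      rw [show Eext = fun _ => ⊤ from funext hall]; exact liminf_const ⊤
    show _ ≤ liminf Eext atTop + liminf Eext atBot
    rw [hl, top_add]; exact le_top
  -- finite data energy
  have hfinψ : (∫⁻ z in Ioi 1, ENNReal.ofReal
      (deriv (fun τ => ψ τ z) 0 ^ 2 + deriv (ψ 0) z ^ 2 + P z * ψ 0 z ^ 2)) < ⊤ :=
    lt_top_iff_ne_top.2 htop
  -- the limits of the channel energies of `ψ`
  have hsolF : ∀ t x, iteratedDeriv 2 (fun τ => ψ τ x) t - iteratedDeriv 2 (ψ t) x + P x * ψ t x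
      = (fun _ _ => (0:ℝ)) t x := hsol
  obtain ⟨Lψp, Lψm, hLp0, hLm0, -, -, hψp, hψm⟩ := wave1D_exists_farEnergy_limits hPc hP0
    continuous_const hψ hsolF (c := 1) (fun _ _ _ => rfl) hfinψ
  have hEext_eq : ∀ t, Eext t = ENNReal.ofReal (∫ z in Ioi (1 + |t|),
      (deriv (fun τ => ψ τ z) t ^ 2 + deriv (ψ t) z ^ 2 + P z * ψ t z ^ 2)) := fun t =>
    ((wave1D_farEnergy_integrableOn hPc hP0 continuous_const hψ hsolF (c := 1)
      (fun _ _ _ => rfl) hfinψ t).2).symm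
  have hlimp : liminf Eext atTop = ENNReal.ofReal Lψp := by
    have h : Tendsto Eext atTop (𝓝 (ENNReal.ofReal Lψp)) := by
      rw [show Eext = fun t => ENNReal.ofReal (∫ z in Ioi (1 + |t|),
        (deriv (fun τ => ψ τ z) t ^ 2 + deriv (ψ t) z ^ 2 + P z * ψ t z ^ 2)) from funext hEext_eq]
      exact ENNReal.tendsto_ofReal hψp
    exact h.liminf_eq
  have hlimm : liminf Eext atBot = ENNReal.ofReal Lψm := by
    have h : Tendsto Eext atBot (𝓝 (ENNReal.ofReal Lψm)) := by
      rw [show Eext = fun t => ENNReal.ofReal (∫ z in Ioi (1 + |t|),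
        (deriv (fun τ => ψ τ z) t ^ 2 + deriv (ψ t) z ^ 2 + P z * ψ t z ^ 2)) from funext hEext_eq]
      exact ENNReal.tendsto_ofReal hψm
    exact h.liminf_eq
  -- the data energies of `ψ − k`
  have hkf_add : ∀ v w : (ℕ → ℝ) × (ℕ → ℝ), ∀ t z, kf (v + w) t z = kf v t z + kf w t z := by
    intro v w t z
    simp only [hkf, Prod.fst_add, Prod.snd_add, Pi.add_apply, add_mul, Finset.sum_add_distrib]
    ring
  set Ek : (ℕ → ℝ) × (ℕ → ℝ) → ℝ := fun v => ∫ z in Ioi 1,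
    (deriv (fun τ => ψ τ z - kf v τ z) 0 ^ 2 + deriv (fun y => ψ 0 y - kf v 0 y) z ^ 2
      + P z * (ψ 0 z - kf v 0 z) ^ 2) with hEk
  have hEk0 : ∀ v, 0 ≤ Ek v := fun v => setIntegral_nonneg measurableSet_Ioi fun z _ => by
    have := hP0 z; positivity
  -- the key step: the claim for `ψ − k_{v₀}`
  have hkey : ∀ v₀ : (ℕ → ℝ) × (ℕ → ℝ), ∀ δ > 0, ∃ v,
      Ek v ≤ 2 * A * (Lψp + Lψm) + Θ * ε ^ 2 * Ek v₀ + δ := by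
    intro v₀ δ hδ
    obtain ⟨hkC, hkres, hkeq, -, hkfin, hkEt, hkt, hkb, -⟩ := hB v₀.1 v₀.2
    obtain ⟨hφC, hFc, hres, hF0, hfinφ, Lp, Lm, hLp, hLm, hTp, hTm⟩ :=
      wave1D_sub_facts hPc hP0 hψ hsol hfinψ hkC hkres hkeq hkfin hkEt hkt hkb hψp hψm
    obtain ⟨α, β, -, hle⟩ := hclaim hPc hP0 hq hε hε1 hPq hqb B
      (fun α β => ⟨(hB α β).1, (hB α β).2.2.2.2.2.2.2.2⟩) _ _ hφC hFc hres hF0 hfinφ Lp Lm hTp hTm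
      δ hδ
    refine ⟨v₀ + (α, β), ?_⟩
    have hfun : ∀ t z, ψ t z - kf (v₀ + (α, β)) t z
        = (ψ t z - kf v₀ t z) - (∑ m ∈ range (n + 1), α m * B 0 m t z
          + ∑ m ∈ range n, β m * B 1 m t z) := by
      intro t z; rw [hkf_add]; simp only [hkf]; ring
    have hEkv : Ek (v₀ + (α, β)) = ∫ z in Ioi 1,
        (deriv (fun τ => (ψ τ z - kf v₀ τ z) - (∑ m ∈ range (n + 1), α m * B 0 m τ z
          + ∑ m ∈ range n, β m * B 1 m τ z)) 0 ^ 2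
        + deriv (fun y => (ψ 0 y - kf v₀ 0 y) - (∑ m ∈ range (n + 1), α m * B 0 m 0 y
          + ∑ m ∈ range n, β m * B 1 m 0 y)) z ^ 2
        + P z * ((ψ 0 z - kf v₀ 0 z) - (∑ m ∈ range (n + 1), α m * B 0 m 0 z
          + ∑ m ∈ range n, β m * B 1 m 0 z)) ^ 2) := by
      simp only [hEk]
      congr 1; funext z
      simp only [hfun]
    rw [hEkv]
    refine hle.trans ?_
    have h1 : A * (Lp + Lm) ≤ 2 * A * (Lψp + Lψm) := by nlinarith
    have h2 : Θ * ε ^ 2 * (∫ z in Ioi 1, (deriv (fun τ => ψ τ z - kf v₀ τ z) 0 ^ 2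
        + deriv (fun y => ψ 0 y - kf v₀ 0 y) z ^ 2 + P z * (ψ 0 z - kf v₀ 0 z) ^ 2))
        = Θ * ε ^ 2 * Ek v₀ := by simp only [hEk]
    linarith [h2.le, h2.ge]
  -- absorption
  have hX : (⨅ v, Ek v) ≤ 2 * (2 * A * (Lψp + Lψm)) :=
    iInf_absorb hEk0 hθ0 hθ hkey
  -- the lower Lebesgue energies of the family
  have hlin : ∀ v, ∫⁻ z in Ioi 1, ENNReal.ofReal (deriv (fun τ => ψ τ z - kf v τ z) 0 ^ 2
      + deriv (fun y => ψ 0 y - kf v 0 y) z ^ 2 + P z * (ψ 0 z - kf v 0 z) ^ 2)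
      = ENNReal.ofReal (Ek v) := by
    intro v
    obtain ⟨hkC, hkres, hkeq, -, hkfin, hkEt, hkt, hkb, -⟩ := hB v.1 v.2
    obtain ⟨hφC, -, -, -, hfinφ, -⟩ :=
      wave1D_sub_facts hPc hP0 hψ hsol hfinψ hkC hkres hkeq hkfin hkEt hkt hkb hψp hψm
    have h := (integrableOn_Ioi_of_lintegral_lt_top
      ((continuous_wave1D_energyDensity hPc hφC).comp (continuous_const.prodMk continuous_id))
      (fun z => wave1D_energyDensity_nonneg (ψ := fun t z => ψ t z - kf v t z) hP0 0 z) hfinφ).2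
    exact h.symm
  -- the infimum over the family is at most `X`
  have hinfle : ∀ v, (⨅ k ∈ Set.range kf,
      ∫⁻ z in Ioi 1, ENNReal.ofReal (deriv (fun τ => ψ τ z - k τ z) 0 ^ 2
        + deriv (fun y => ψ 0 y - k 0 y) z ^ 2 + P z * (ψ 0 z - k 0 z) ^ 2))
      ≤ ENNReal.ofReal (Ek v) := fun v =>
    (iInf₂_le (kf v) (Set.mem_range_self v)).trans (le_of_eq (hlin v))
  have hbdd : BddBelow (Set.range Ek) := ⟨0, by rintro _ ⟨v, rfl⟩; exact hEk0 v⟩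
  have hinfX : (⨅ k ∈ Set.range kf,
      ∫⁻ z in Ioi 1, ENNReal.ofReal (deriv (fun τ => ψ τ z - k τ z) 0 ^ 2
        + deriv (fun y => ψ 0 y - k 0 y) z ^ 2 + P z * (ψ 0 z - k 0 z) ^ 2))
      ≤ ENNReal.ofReal (⨅ v, Ek v) := by
    refine ENNReal.le_of_forall_pos_le_add fun η hη _ => ?_
    have hlt : (⨅ v, Ek v) < (⨅ v, Ek v) + η := by
      have : (0:ℝ) < η := hη; linarith
    obtain ⟨v, hv⟩ := exists_lt_of_ciInf_lt hlt
    calc _ ≤ ENNReal.ofReal (Ek v) := hinfle v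
      _ ≤ ENNReal.ofReal ((⨅ v, Ek v) + η) := ENNReal.ofReal_le_ofReal hv.le
      _ = ENNReal.ofReal (⨅ v, Ek v) + η := by
          rw [ENNReal.ofReal_add (le_ciInf hEk0) (NNReal.coe_nonneg η), ENNReal.ofReal_coe_nnreal]
  -- conclusion
  have hL0 : 0 ≤ Lψp + Lψm := by linarith
  have hcX : 1 / (4 * A + 4) * (⨅ v, Ek v) ≤ Lψp + Lψm := by
    rw [one_div, inv_mul_le_iff₀ (by positivity)]
    nlinarith
  show ENNReal.ofReal (1 / (4 * A + 4)) * _ ≤ liminf Eext atTop + liminf Eext atBot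
  rw [hlimp, hlimm, ← ENNReal.ofReal_add hLp0 hLm0]
  calc ENNReal.ofReal (1 / (4 * A + 4)) * _
      ≤ ENNReal.ofReal (1 / (4 * A + 4)) * ENNReal.ofReal (⨅ v, Ek v) := by gcongr
    _ = ENNReal.ofReal (1 / (4 * A + 4) * ⨅ v, Ek v) := (ENNReal.ofReal_mul (by positivity)).symm
    _ ≤ ENNReal.ofReal (Lψp + Lψm) := ENNReal.ofReal_le_ofReal hcX

end Literature.Analysis.PDE
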